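import Mathlib
import HarnessLib
import Summits.AtomisticToContinuum.Crystallization.Theorems.PricedLinkCensusSoftLayerPropagationStubBallPropagationLayers
import Summits.AtomisticToContinuum.Crystallization.Theorems.PricedLinkCensusSoftLayerPropagationStubBallPropagationHoles

/-!
# Local layer-propagation lemmas for the finite-ball form of Hales, *Dense Sphere Packings* §1.3 (VIII):
# the FCC zone — one layer forces the next with no far corner

Route `PricedLinkCensus`, crux `SoftLayerPropagation` (stmt-AtomisticToContinuum-14233), line
`Sketch`, eighth helper file for the stub `stub_ballPropagation` (frame `u₁, u₂, w, 𝗁 e₃` of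
`LayerShells.lean`; uses `…Layers.lean` and `…Holes.lean`).

In `…Holes.lean` the hexagon of a pattern site above an occupied hole needs the far corner
`p + 3t` to be a centre, because a LATERAL triangle of an anticuboctahedron (a twin plane tilted
against the layers) has to be excluded by the packing.  When the new shell is FCC-arranged nothing
has to be excluded: the cuboctahedron is closed under differences of adjacent vertices
(`sub_mem_kissingShell_of_fcc`).  So inside a ball all of whose centres are FCC-arranged — e.g. the
open ball about the centre of the stub's ball whose radius is the distance to the nearest
HCP-arranged centre — the layer-by-layer reconstruction is loss-free: a centre above a hole of a
full centre is full.  This file records these FCC forms of the lemmas of `…Holes.lean` and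
`…Steps.lean`:

* `hexagon_subset_kissingShell_of_hole_fcc`, `hexagonSet_subset_kissingShell_of_holeTriple_fcc`,
  `hexagonSet_subset_kissingShell_above_fcc` / `…_below_fcc`,
  `exists_kissingShell_above_eq_layerShell_fcc` / `…_below_…`;
* the small frame lemmas they share with `…Steps.lean` (which imports this file):
  `add_mem_of_kissingShell_eq_layerShell`, `inner_frameW_of_mem_holeTriple_one`,
  `eq_of_mem_holeTriple_of_mem_holeTriple` (the two hole triples are disjoint),
  `inner_self_holeTriple_add_smul_frameE` (a lifted hole point has norm `2`).

All statements are elementary ([folklore]).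
-/

noncomputable section

namespace Summit.AtomisticToContinuum.Crystallization.Theorems

open Literature.Geometry.DiscreteGeometry Literature.MathematicalPhysics.StatisticalMechanics
open RealInnerProductSpace

/-! ### Over an occupied hole, FCC target -/

/-- **An FCC shell over an occupied hole contains the hexagon — no far corner needed.**  As in
`hexagon_subset_kissingShell_of_hole`, but for an FCC-arranged shell of `p + d`: the differences of
the triangle `−d, η − d, η′ − d` of shell points are shell points outright
(`sub_mem_kissingShell_of_fcc`), so only the corners `p, p + η, p + η′` have to be centres.  This is
what makes the reconstruction loss-free inside a ball all of whose centres are FCC. [folklore] -/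
theorem hexagon_subset_kissingShell_of_hole_fcc {V : Set (EuclideanSpace ℝ (Fin 3))}
    {η η' d p : EuclideanSpace ℝ (Fin 3)}
    (hη : ⟪η, η⟫ = 4) (hη' : ⟪η', η'⟫ = 4) (hηη' : ⟪η, η'⟫ = 2)
    (hd : ⟪d, d⟫ = 4) (hdη : ⟪d, η⟫ = 2) (hdη' : ⟪d, η'⟫ = 2)
    (hp : p ∈ V) (h₁ : p + η ∈ V) (h₂ : p + η' ∈ V)
    (hfcc : IsArrangedIn (kissingShell V (p + d)) fccKissingPattern) :
    ({η, -η, η', -η', η - η', η' - η} : Set (EuclideanSpace ℝ (Fin 3))) ⊆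
      kissingShell V (p + d) := by
  have hη'η : ⟪η', η⟫ = 2 := by rw [real_inner_comm, hηη']
  have hηd : ⟪η, d⟫ = 2 := by rw [real_inner_comm, hdη]
  have hη'd : ⟪η', d⟫ = 2 := by rw [real_inner_comm, hdη']
  set y := p + d with hy
  -- the triangle below/above `y`
  have m₁ : -d ∈ kissingShell V y :=
    mem_kissingShell_of_inner (by rw [hy, add_neg_cancel_right]; exact hp)
      (by simp only [inner_neg_left, inner_neg_right, hd, neg_neg])
  have m₂ : η - d ∈ kissingShell V y :=
    mem_kissingShell_of_inner
      (by have : y + (η - d) = p + η := by rw [hy]; abel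
          rw [this]; exact h₁)
      (by simp only [inner_sub_left, inner_sub_right, hη, hd, hdη, hηd]; norm_num)
  have m₃ : η' - d ∈ kissingShell V y :=
    mem_kissingShell_of_inner
      (by have : y + (η' - d) = p + η' := by rw [hy]; abel
          rw [this]; exact h₂)
      (by simp only [inner_sub_left, inner_sub_right, hη', hd, hdη', hη'd]; norm_num)
  have d₁₂ : dist (-d) (η - d) = 2 := dist_eq_two_iff_inner.2 (by
    have : -d - (η - d) = -η := by abel
    rw [this]; simp only [inner_neg_left, inner_neg_right, hη, neg_neg])
  have d₂₁ : dist (η - d) (-d) = 2 := by rw [dist_comm, d₁₂]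
  have d₁₃ : dist (-d) (η' - d) = 2 := dist_eq_two_iff_inner.2 (by
    have : -d - (η' - d) = -η' := by abel
    rw [this]; simp only [inner_neg_left, inner_neg_right, hη', neg_neg])
  have d₃₁ : dist (η' - d) (-d) = 2 := by rw [dist_comm, d₁₃]
  have d₂₃ : dist (η - d) (η' - d) = 2 := dist_eq_two_iff_inner.2 (by
    have : η - d - (η' - d) = η - η' := by abel
    rw [this]; simp only [inner_sub_left, inner_sub_right, hη, hη', hηη', hη'η]; norm_num)
  have d₃₂ : dist (η' - d) (η - d) = 2 := by rw [dist_comm, d₂₃]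
  -- the six differences
  have e₁ : η = η - d - -d := by abel
  have e₂ : -η = -d - (η - d) := by abel
  have e₃ : η' = η' - d - -d := by abel
  have e₄ : -η' = -d - (η' - d) := by abel
  have e₅ : η - η' = η - d - (η' - d) := by abel
  have e₆ : η' - η = η' - d - (η - d) := by abel
  have k₁ : η ∈ kissingShell V y :=
    e₁ ▸ sub_mem_kissingShell_of_fcc hfcc m₂ m₁ d₂₁
  have k₂ : -η ∈ kissingShell V y :=
    e₂ ▸ sub_mem_kissingShell_of_fcc hfcc m₁ m₂ d₁₂
  have k₃ : η' ∈ kissingShell V y :=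
    e₃ ▸ sub_mem_kissingShell_of_fcc hfcc m₃ m₁ d₃₁
  have k₄ : -η' ∈ kissingShell V y :=
    e₄ ▸ sub_mem_kissingShell_of_fcc hfcc m₁ m₃ d₁₃
  have k₅ : η - η' ∈ kissingShell V y :=
    e₅ ▸ sub_mem_kissingShell_of_fcc hfcc m₂ m₃ d₂₃
  have k₆ : η' - η ∈ kissingShell V y :=
    e₆ ▸ sub_mem_kissingShell_of_fcc hfcc m₃ m₂ d₃₂
  intro x hx
  simp only [Set.mem_insert_iff, Set.mem_singleton_iff] at hx
  rcases hx with rfl | rfl | rfl | rfl | rfl | rfl <;> assumption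

/-- **The site over a hole, in the frame, FCC target — no far corner needed.**  `p` a centre with
occupied hexagon, `t ∈ holeTriple σ`, `s = ±1`; if the shell of `p + t + s 𝗁 e₃` is FCC-arranged it
contains the standard hexagon (`hexagon_subset_kissingShell_of_hole_fcc` for the hexagonal pair of
the hole `t`). [folklore] -/
theorem hexagonSet_subset_kissingShell_of_holeTriple_fcc {V : Set (EuclideanSpace ℝ (Fin 3))}
    {σ s : ℝ} (hσ : σ = 1 ∨ σ = -1) (hs : s = 1 ∨ s = -1)
    {p t : EuclideanSpace ℝ (Fin 3)} (hp : p ∈ V) (hH : ∀ x ∈ hexagonSet, p + x ∈ V)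
    (ht : t ∈ holeTriple σ)
    (hfcc : IsArrangedIn (kissingShell V (p + (t + s • layerNormal layerSpacing))) fccKissingPattern) :
    hexagonSet ⊆ kissingShell V (p + (t + s • layerNormal layerSpacing)) := by
  have hs2 : s * s = 1 := by rcases hs with rfl | rfl <;> norm_num
  -- the generic step, for the hexagonal pair `(η, η')` of the hole `t`
  have key : ∀ η η' : EuclideanSpace ℝ (Fin 3),
      hexagonSet = ({η, -η, η', -η', η - η', η' - η} : Set (EuclideanSpace ℝ (Fin 3))) →
      ⟪η, η⟫ = 4 → ⟪η', η'⟫ = 4 → ⟪η, η'⟫ = 2 → ⟪t, η⟫ = 2 → ⟪t, η'⟫ = 2 → ⟪t, t⟫ = 4 / 3 →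
      ⟪t, layerNormal layerSpacing⟫ = 0 →
      hexagonSet ⊆ kissingShell V (p + (t + s • layerNormal layerSpacing)) := by
    intro η η' hhex hη hη' hηη' htη htη' htt hte
    have h₁ : p + η ∈ V := hH η (by rw [hhex]; simp)
    have h₂ : p + η' ∈ V := hH η' (by rw [hhex]; simp)
    have het : ⟪layerNormal layerSpacing, t⟫ = 0 := by rw [real_inner_comm, hte]
    have hee : ⟪(layerNormal layerSpacing : EuclideanSpace ℝ (Fin 3)), layerNormal layerSpacing⟫ =
        8 / 3 := inner_frameE_frameE
    have heη : ⟪layerNormal layerSpacing, η⟫ = 0 := by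
      rw [inner_fin3, apply_two_of_mem_hexagonSet (show η ∈ hexagonSet by rw [hhex]; simp)]; simp
    have heη' : ⟪layerNormal layerSpacing, η'⟫ = 0 := by
      rw [inner_fin3, apply_two_of_mem_hexagonSet (show η' ∈ hexagonSet by rw [hhex]; simp)]; simp
    have hd : ⟪t + s • layerNormal layerSpacing, t + s • layerNormal layerSpacing⟫ = 4 := by
      simp only [inner_add_left, inner_add_right, inner_smul_left, inner_smul_right, htt, hte, het,
        hee, RCLike.conj_to_real]
      linear_combination (8 / 3 : ℝ) * hs2
    have hdη : ⟪t + s • layerNormal layerSpacing, η⟫ = 2 := by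
      simp only [inner_add_left, inner_smul_left, htη, heη, RCLike.conj_to_real]; ring
    have hdη' : ⟪t + s • layerNormal layerSpacing, η'⟫ = 2 := by
      simp only [inner_add_left, inner_smul_left, htη', heη', RCLike.conj_to_real]; ring
    rw [hhex]
    exact hexagon_subset_kissingShell_of_hole_fcc hη hη' hηη' hd hdη hdη' hp h₁ h₂ hfcc
  -- the six holes
  rw [mem_holeTriple_iff] at ht
  obtain ⟨t₁, ht₁, rfl⟩ := ht
  rw [mem_holeTriple_one_iff] at ht₁
  have hwe : ⟪(barlowOffset 2 : EuclideanSpace ℝ (Fin 3)), layerNormal layerSpacing⟫ = 0 :=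
    inner_frameW_frameE
  rcases hσ with rfl | rfl <;> rcases ht₁ with rfl | rfl | rfl
  · -- `t = w`: pair `(u₁, u₂)`
    refine key _ _ hexagonSet_eq_uv inner_frameU_frameU inner_frameV_frameV inner_frameU_frameV
      ?_ ?_ ?_ ?_
    · simp only [one_smul, inner_frameW_frameU]
    · simp only [one_smul, inner_frameW_frameV]
    · simp only [one_smul, inner_frameW_frameW]
    · simp only [one_smul, inner_frameW_frameE]
  · -- `t = w − u₁`: pair `(−u₁, u₂ − u₁)`
    refine key _ _ hexagonSet_eq_nu_vmu ?_ inner_self_frameV_sub_frameU ?_ ?_ ?_ ?_ ?_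
    · simp only [inner_neg_left, inner_neg_right, inner_frameU_frameU, neg_neg]
    · simp only [inner_neg_left, inner_sub_right, inner_frameU_frameV, inner_frameU_frameU]; norm_num
    · simp only [one_smul, inner_sub_left, inner_neg_right, inner_frameW_frameU, inner_frameU_frameU]
      norm_num
    · simp only [one_smul, inner_sub_left, inner_sub_right, inner_frameW_frameV, inner_frameW_frameU,
        inner_frameU_frameV, inner_frameU_frameU]; norm_num
    · simp only [one_smul, inner_sub_left, inner_sub_right, inner_frameW_frameW, inner_frameW_frameU,
        inner_frameU_frameW, inner_frameU_frameU]; norm_num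
    · simp only [one_smul, inner_sub_left, inner_frameW_frameE, inner_frameU_frameE]; norm_num
  · -- `t = w − u₂`: pair `(−u₂, u₁ − u₂)`
    refine key _ _ hexagonSet_eq_nv_umv ?_ inner_self_frameU_sub_frameV ?_ ?_ ?_ ?_ ?_
    · simp only [inner_neg_left, inner_neg_right, inner_frameV_frameV, neg_neg]
    · simp only [inner_neg_left, inner_sub_right, inner_frameV_frameU, inner_frameV_frameV]; norm_num
    · simp only [one_smul, inner_sub_left, inner_neg_right, inner_frameW_frameV, inner_frameV_frameV]
      norm_num
    · simp only [one_smul, inner_sub_left, inner_sub_right, inner_frameW_frameU, inner_frameW_frameV,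
        inner_frameV_frameU, inner_frameV_frameV]; norm_num
    · simp only [one_smul, inner_sub_left, inner_sub_right, inner_frameW_frameW, inner_frameW_frameV,
        inner_frameV_frameW, inner_frameV_frameV]; norm_num
    · simp only [one_smul, inner_sub_left, inner_frameW_frameE, inner_frameV_frameE]; norm_num
  · -- `t = −w`: pair `(−u₁, −u₂)`
    refine key _ _ hexagonSet_eq_nu_nv ?_ ?_ ?_ ?_ ?_ ?_ ?_
    · simp only [inner_neg_left, inner_neg_right, inner_frameU_frameU, neg_neg]
    · simp only [inner_neg_left, inner_neg_right, inner_frameV_frameV, neg_neg]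
    · simp only [inner_neg_left, inner_neg_right, inner_frameU_frameV, neg_neg]
    · simp only [neg_smul, one_smul, inner_neg_left, inner_neg_right, inner_frameW_frameU, neg_neg]
    · simp only [neg_smul, one_smul, inner_neg_left, inner_neg_right, inner_frameW_frameV, neg_neg]
    · simp only [neg_smul, one_smul, inner_neg_left, inner_neg_right, inner_frameW_frameW, neg_neg]
    · simp only [neg_smul, one_smul, inner_neg_left, inner_frameW_frameE, neg_zero]
  · -- `t = u₁ − w`: pair `(u₁, u₁ − u₂)`
    refine key _ _ hexagonSet_eq_u_umv inner_frameU_frameU inner_self_frameU_sub_frameV ?_ ?_ ?_ ?_ ?_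
    · simp only [inner_sub_right, inner_frameU_frameU, inner_frameU_frameV]; norm_num
    · simp only [neg_smul, one_smul, neg_sub, inner_sub_left, inner_frameU_frameU, inner_frameW_frameU]
      norm_num
    · simp only [neg_smul, one_smul, neg_sub, inner_sub_left, inner_sub_right, inner_frameU_frameU,
        inner_frameU_frameV, inner_frameW_frameU, inner_frameW_frameV]; norm_num
    · simp only [neg_smul, one_smul, neg_sub, inner_sub_left, inner_sub_right, inner_frameU_frameU,
        inner_frameU_frameW, inner_frameW_frameU, inner_frameW_frameW]; norm_num
    · simp only [neg_smul, one_smul, neg_sub, inner_sub_left, inner_frameU_frameE, inner_frameW_frameE]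
      norm_num
  · -- `t = u₂ − w`: pair `(u₂, u₂ − u₁)`
    refine key _ _ hexagonSet_eq_v_vmu inner_frameV_frameV inner_self_frameV_sub_frameU ?_ ?_ ?_ ?_ ?_
    · simp only [inner_sub_right, inner_frameV_frameV, inner_frameV_frameU]; norm_num
    · simp only [neg_smul, one_smul, neg_sub, inner_sub_left, inner_frameV_frameV, inner_frameW_frameV]
      norm_num
    · simp only [neg_smul, one_smul, neg_sub, inner_sub_left, inner_sub_right, inner_frameV_frameV,
        inner_frameV_frameU, inner_frameW_frameV, inner_frameW_frameU]; norm_num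
    · simp only [neg_smul, one_smul, neg_sub, inner_sub_left, inner_sub_right, inner_frameV_frameV,
        inner_frameV_frameW, inner_frameW_frameV, inner_frameW_frameW]; norm_num
    · simp only [neg_smul, one_smul, neg_sub, inner_sub_left, inner_frameV_frameE, inner_frameW_frameE]
      norm_num

/-! ### Above and below a centre with a layer shell, FCC target -/

/-- The hexagon neighbours of a centre with a layer shell are centres. [folklore] -/
theorem add_mem_of_kissingShell_eq_layerShell {V : Set (EuclideanSpace ℝ (Fin 3))} {σ σ' : ℝ}
    {p : EuclideanSpace ℝ (Fin 3)} (hshell : kissingShell V p = layerShell σ σ') :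
    ∀ x ∈ hexagonSet, p + x ∈ V := fun x hx => by
  have : x ∈ kissingShell V p := by rw [hshell]; exact hexagonSet_subset_layerShell _ _ hx
  exact this.1

/-- **Upward step, FCC target.**  If the centre `p` has shell `layerShell σ σ′`, `t ∈ holeTriple σ`
and the shell of the centre `p + t + 𝗁 e₃` above `p` is FCC-arranged, then that shell contains the
standard hexagon (no far corner needed). [folklore] -/
theorem hexagonSet_subset_kissingShell_above_fcc {V : Set (EuclideanSpace ℝ (Fin 3))}
    {σ σ' : ℝ} (hσ : σ = 1 ∨ σ = -1) {p t : EuclideanSpace ℝ (Fin 3)}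
    (hshell : kissingShell V p = layerShell σ σ') (hp : p ∈ V) (ht : t ∈ holeTriple σ)
    (hfcc : IsArrangedIn (kissingShell V (p + (t + layerNormal layerSpacing))) fccKissingPattern) :
    hexagonSet ⊆ kissingShell V (p + (t + layerNormal layerSpacing)) := by
  have key := hexagonSet_subset_kissingShell_of_holeTriple_fcc hσ (s := 1) (Or.inl rfl) hp
    (add_mem_of_kissingShell_eq_layerShell hshell) ht
  rw [one_smul] at key
  exact key hfcc

/-- **Downward step, FCC target** (mirror image). [folklore] -/
theorem hexagonSet_subset_kissingShell_below_fcc {V : Set (EuclideanSpace ℝ (Fin 3))}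
    {σ σ' : ℝ} (hσ' : σ' = 1 ∨ σ' = -1) {p t : EuclideanSpace ℝ (Fin 3)}
    (hshell : kissingShell V p = layerShell σ σ') (hp : p ∈ V) (ht : t ∈ holeTriple σ')
    (hfcc : IsArrangedIn (kissingShell V (p + (t - layerNormal layerSpacing))) fccKissingPattern) :
    hexagonSet ⊆ kissingShell V (p + (t - layerNormal layerSpacing)) := by
  have key := hexagonSet_subset_kissingShell_of_holeTriple_fcc hσ' (s := -1) (Or.inr rfl) hp
    (add_mem_of_kissingShell_eq_layerShell hshell) ht
  rw [neg_one_smul, ← sub_eq_add_neg] at key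
  exact key hfcc


/-! ### Types, FCC target -/

/-- Inner products of the basic hole points with `w` are `4/3` or `−2/3`. [folklore] -/
theorem inner_frameW_of_mem_holeTriple_one {x : EuclideanSpace ℝ (Fin 3)} (hx : x ∈ holeTriple 1) :
    ⟪x, barlowOffset 2⟫ = 4 / 3 ∨ ⟪x, barlowOffset 2⟫ = -(2 / 3) := by
  rw [mem_holeTriple_one_iff] at hx
  rcases hx with rfl | rfl | rfl
  · exact Or.inl inner_frameW_frameW
  · right; simp only [inner_sub_left, inner_frameW_frameW, inner_frameU_frameW]; norm_num
  · right; simp only [inner_sub_left, inner_frameW_frameW, inner_frameV_frameW]; norm_num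

/-- **The two hole triples are disjoint**: a point of `holeTriple σ₁` and of `holeTriple σ₂`
(`σᵢ = ±1`) forces `σ₁ = σ₂`. [folklore] -/
theorem eq_of_mem_holeTriple_of_mem_holeTriple {σ₁ σ₂ : ℝ} (h₁ : σ₁ = 1 ∨ σ₁ = -1)
    (h₂ : σ₂ = 1 ∨ σ₂ = -1) {x : EuclideanSpace ℝ (Fin 3)} (hx₁ : x ∈ holeTriple σ₁)
    (hx₂ : x ∈ holeTriple σ₂) : σ₁ = σ₂ := by
  by_contra hne
  -- one of `x`, `−x` is in `holeTriple 1`, the other in `holeTriple (−1)`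
  have key : ∀ z : EuclideanSpace ℝ (Fin 3), z ∈ holeTriple 1 → -z ∈ holeTriple 1 → False := by
    intro z hz hz'
    rcases inner_frameW_of_mem_holeTriple_one hz with h | h <;>
      rcases inner_frameW_of_mem_holeTriple_one hz' with h' | h' <;>
      · rw [inner_neg_left] at h'; linarith
  rcases h₁ with rfl | rfl <;> rcases h₂ with rfl | rfl
  · exact hne rfl
  · exact key x hx₁ (neg_mem_holeTriple_iff.2 hx₂)
  · exact key x hx₂ (neg_mem_holeTriple_iff.2 hx₁)
  · exact hne rfl

/-- A hole point lifted to a side has norm `2`: `⟪t + s 𝗁e₃, t + s 𝗁e₃⟫ = 4/3 + 8/3`. [folklore] -/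
theorem inner_self_holeTriple_add_smul_frameE {σ s : ℝ} (hσ : σ = 1 ∨ σ = -1) (hs : s = 1 ∨ s = -1)
    {t : EuclideanSpace ℝ (Fin 3)} (ht : t ∈ holeTriple σ) :
    ⟪t + s • layerNormal layerSpacing, t + s • layerNormal layerSpacing⟫ = 4 := by
  have hs2 : s * s = 1 := by rcases hs with rfl | rfl <;> norm_num
  have htt : ⟪t, t⟫ = 4 / 3 := inner_self_of_mem_holeTriple hσ ht
  have hte : ⟪t, layerNormal layerSpacing⟫ = 0 := by
    rw [inner_fin3, apply_two_of_mem_holeTriple ht]; simp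
  have het : ⟪layerNormal layerSpacing, t⟫ = 0 := by rw [real_inner_comm, hte]
  have hee : ⟪(layerNormal layerSpacing : EuclideanSpace ℝ (Fin 3)), layerNormal layerSpacing⟫ =
      8 / 3 := inner_frameE_frameE
  simp only [inner_add_left, inner_add_right, inner_smul_left, inner_smul_right, htt, hte, het, hee,
    RCLike.conj_to_real]
  linear_combination (8 / 3 : ℝ) * hs2
/-- **Upward step with types, FCC target**: the FCC-arranged shell of the centre `p + t + 𝗁 e₃`
above a centre `p` with shell `layerShell σ σ′` (`t ∈ holeTriple σ`) is `layerShell τ (−σ)` for a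
sign `τ` (in fact `τ = σ`, the shell being FCC, which is not recorded here). [folklore] -/
theorem exists_kissingShell_above_eq_layerShell_fcc {V : Set (EuclideanSpace ℝ (Fin 3))}
    (hV : IsUnitBallPacking V) {σ σ' : ℝ} (hσ : σ = 1 ∨ σ = -1) {p t : EuclideanSpace ℝ (Fin 3)}
    (hshell : kissingShell V p = layerShell σ σ') (hp : p ∈ V) (ht : t ∈ holeTriple σ)
    (hfcc : IsArrangedIn (kissingShell V (p + (t + layerNormal layerSpacing))) fccKissingPattern) :
    ∃ τ : ℝ, (τ = 1 ∨ τ = -1) ∧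
      kissingShell V (p + (t + layerNormal layerSpacing)) = layerShell τ (-σ) := by
  have hH := hexagonSet_subset_kissingShell_above_fcc hσ hshell hp ht hfcc
  obtain ⟨τ, τ', hτ, hτ', hS⟩ :=
    (isTwelveConfig_kissingShell_of_isArrangedIn hV (Or.inl hfcc)).eq_layerShell hH
  refine ⟨τ, hτ, ?_⟩
  have hm : -(t + layerNormal layerSpacing) ∈ kissingShell V (p + (t + layerNormal layerSpacing)) :=
    mem_kissingShell_of_inner (by rw [add_neg_cancel_right]; exact hp)
      (by rw [inner_neg_left, inner_neg_right, neg_neg]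
          simpa using inner_self_holeTriple_add_smul_frameE hσ (s := 1) (Or.inl rfl) ht)
  rw [hS] at hm
  have ht2 : t 2 = 0 := apply_two_of_mem_holeTriple ht
  rcases mem_layerShell_iff.1 hm with h | h | h
  · have h0 := apply_two_of_mem_hexagonSet h
    simp only [PiLp.neg_apply, PiLp.add_apply, ht2, frameE_apply_two] at h0
    linarith [layerSpacing_pos]
  · have h0 := apply_two_of_mem_holeTriple h
    simp only [PiLp.sub_apply, PiLp.neg_apply, PiLp.add_apply, ht2, frameE_apply_two] at h0
    linarith [layerSpacing_pos]
  · have h' : -t ∈ holeTriple τ' := by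
      have e : -(t + layerNormal layerSpacing) + layerNormal layerSpacing = -t := by abel
      rw [e] at h; exact h
    rw [neg_mem_holeTriple_iff] at h'
    have hnτ' : -τ' = 1 ∨ -τ' = -1 := by rcases hτ' with rfl | rfl <;> norm_num
    have := eq_of_mem_holeTriple_of_mem_holeTriple hσ hnτ' ht h'
    rw [hS, this, neg_neg]

/-- **Downward step with types, FCC target** (mirror image). [folklore] -/
theorem exists_kissingShell_below_eq_layerShell_fcc {V : Set (EuclideanSpace ℝ (Fin 3))}
    (hV : IsUnitBallPacking V) {σ σ' : ℝ} (hσ' : σ' = 1 ∨ σ' = -1) {p t : EuclideanSpace ℝ (Fin 3)}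
    (hshell : kissingShell V p = layerShell σ σ') (hp : p ∈ V) (ht : t ∈ holeTriple σ')
    (hfcc : IsArrangedIn (kissingShell V (p + (t - layerNormal layerSpacing))) fccKissingPattern) :
    ∃ τ' : ℝ, (τ' = 1 ∨ τ' = -1) ∧
      kissingShell V (p + (t - layerNormal layerSpacing)) = layerShell (-σ') τ' := by
  have hH := hexagonSet_subset_kissingShell_below_fcc hσ' hshell hp ht hfcc
  obtain ⟨τ, τ', hτ, hτ', hS⟩ :=
    (isTwelveConfig_kissingShell_of_isArrangedIn hV (Or.inl hfcc)).eq_layerShell hH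
  refine ⟨τ', hτ', ?_⟩
  have hm : -(t - layerNormal layerSpacing) ∈ kissingShell V (p + (t - layerNormal layerSpacing)) :=
    mem_kissingShell_of_inner (by rw [add_neg_cancel_right]; exact hp)
      (by rw [inner_neg_left, inner_neg_right, neg_neg]
          have := inner_self_holeTriple_add_smul_frameE hσ' (s := -1) (Or.inr rfl) ht
          rwa [neg_one_smul, ← sub_eq_add_neg] at this)
  rw [hS] at hm
  have ht2 : t 2 = 0 := apply_two_of_mem_holeTriple ht
  rcases mem_layerShell_iff.1 hm with h | h | h
  · have h0 := apply_two_of_mem_hexagonSet h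
    simp only [PiLp.neg_apply, PiLp.sub_apply, ht2, frameE_apply_two] at h0
    linarith [layerSpacing_pos]
  · have h' : -t ∈ holeTriple τ := by
      have e : -(t - layerNormal layerSpacing) - layerNormal layerSpacing = -t := by abel
      rw [e] at h; exact h
    rw [neg_mem_holeTriple_iff] at h'
    have hnτ : -τ = 1 ∨ -τ = -1 := by rcases hτ with rfl | rfl <;> norm_num
    have := eq_of_mem_holeTriple_of_mem_holeTriple hσ' hnτ ht h'
    rw [hS, this, neg_neg]
  · have h0 := apply_two_of_mem_holeTriple h
    simp only [PiLp.add_apply, PiLp.neg_apply, PiLp.sub_apply, ht2, frameE_apply_two] at h0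
    linarith [layerSpacing_pos]

/-- **Registered sub-goal `ballPropagation_nextShellAboveFcc`** of the crux item (the upward
step with types for an FCC target, in closed form): `exists_kissingShell_above_eq_layerShell_fcc`.
[folklore] -/
theorem ballPropagation_nextShellAboveFcc :
    ∀ (V : Set (EuclideanSpace ℝ (Fin 3))), Literature.Geometry.DiscreteGeometry.IsUnitBallPacking
    V → ∀ (σ σ' : ℝ), (σ = 1 ∨ σ = -1) → ∀ (p t : EuclideanSpace ℝ (Fin 3)),
    Literature.Geometry.DiscreteGeometry.kissingShell V p =
    Literature.Geometry.DiscreteGeometry.layerShell σ σ' → p ∈ V → t ∈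
    Literature.Geometry.DiscreteGeometry.holeTriple σ →
    Literature.Geometry.DiscreteGeometry.IsArrangedIn
    (Literature.Geometry.DiscreteGeometry.kissingShell V (p + (t +
    Literature.MathematicalPhysics.StatisticalMechanics.layerNormal
    Literature.Geometry.DiscreteGeometry.layerSpacing)))
    Literature.Geometry.DiscreteGeometry.fccKissingPattern → ∃ τ : ℝ, (τ = 1 ∨ τ = -1) ∧
    Literature.Geometry.DiscreteGeometry.kissingShell V (p + (t +
    Literature.MathematicalPhysics.StatisticalMechanics.layerNormal
    Literature.Geometry.DiscreteGeometry.layerSpacing)) =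
    Literature.Geometry.DiscreteGeometry.layerShell τ (-σ) :=
  fun _ hV _ _ hσ _ _ hshell hp ht hfcc =>
    exists_kissingShell_above_eq_layerShell_fcc hV hσ hshell hp ht hfcc

end Summit.AtomisticToContinuum.Crystallization.Theorems

end
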